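/-
Copyright (c) 2026. All rights reserved.
Released under Apache 2.0 license as described in the file LICENSE.
-/
import Literature.Geometry.Kaehler.ComplexTorusQuaternionXSixAtkinLehnerMovesSpecialPoints
import Literature.Geometry.Kaehler.ComplexTorusQuaternionXSixSpecialCyclesNormaliserClassBounds
import HarnessLib

/-!
# The points of `Z(t)` on `X₆⁺ = X₆/W`, COUNTED: for `t ≡ 19 (mod 24)` the `Γ₆`-classes of `Z(t)`-points of `ℌ` are
# exactly four times the `Γ₆⁺`-classes, `Γ₆⁺ = N(O₆)_{>0}`; hence `#(Pt(t)/Γ₆⁺) = |L(t)/N(O₆)|` (`= 1` for `t = 19`)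

[tag: complex_torus] [tag: abelian_surface] [tag: quaternion_multiplication] [tag: complex_multiplication]
[tag: shimura_curve] [tag: special_cycles] [tag: atkin_lehner]

`Pt(t) = {τ ∈ ℌ : ρ(x)τ = τ for some x ∈ 𝔬, tr x = 0, nr x = t}` (the lifted support of `Z(t)`, `…XSixSpecialCyclesPointCount`),
`Γ₆ = O₆¹` acting through `ρ`, and `Γ₆⁺ = {g ≠ 0 : gO₆ ⊆ O₆g, nr g > 0} = ℚ_{>0}·Γ₆·{1, w₂, μ, w₆}` (the positive-norm
part of the normaliser, Bayer–Travesa's `Γ₆⁺ ⊃ Γ₆` with `Γ₆⁺/ℚ^×Γ₆ ≅ (ℤ/2ℤ)²`), also acting on `ℌ`.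

* `specialPointsPlus_equivalence`, `specialPointsPlus_mk_eq_iff` (§1): `Γ₆⁺`-equivalence of points is an equivalence
  relation (inverse through `ḡ`, `nr ḡ = nr g > 0`).
* `card_specialPoints_eq_four_mul_card_specialPointsPlus` (§2): **for `t > 0`, `3 ∤ t`, `t ≡ 3 (mod 4)`:
  `#(Pt(t)/Γ₆) = 4·#(Pt(t)/Γ₆⁺)`** — the maps `[τ] ↦ [ρ(μ)τ]`, `[τ] ↦ [ρ(w₂)τ]` are well defined on `Pt(t)/Γ₆`
  (`w₂, μ` normalise `O₆` and `𝔬 ∩ B⁰`), `ρ(w₂)` is an involution on classes (`w₂² = 2i`), all three of `ρ(μ)`, `ρ(w₂)`,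
  `ρ(w₂μ) = ρ(w₆)` MOVE every class (`…XSixAtkinLehnerMovesSpecialPoints`), and `Γ₆⁺`-classes are exactly their orbits
  (`N(O₆)` exhausted; a positive-norm `q·v·W` has `v ∈ Γ₆`): a four-sheeted cover.
* `card_specialPointsPlus_eq_card_normaliser_classes` (§2): **`#(Pt(t)/Γ₆⁺) = |L(t)/N(O₆)|`** for these `t` — with
  `#(Pt(t)/Γ₆) = |L(t)/O₆^×| = 4·|L(t)/N(O₆)|` (`…NormaliserClassBounds`): the points of `Z(t)` on `X₆⁺` are counted by
  the special vectors up to Atkin–Lehner; `card_specialPointsPlus_nineteen`: **`Z(19)` has ONE point on `X₆⁺`**.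

## The print

* S. Kudla, M. Rapoport, T. Yang (2006), §3.4 Remark 3.4.7 («the group of Atkin-Lehner involutions permutes the
  components transitively … we consider only cycles which are invariant under the group of Atkin-Lehner involutions»),
  (3.4.11) «`[Γ∖D_t] ≃ Z(t)_ℂ`». [cite: KudlaRapoportYang2006, §3.4 Remark 3.4.7]
* P. Bayer, A. Travesa (2007), §2 («`Γ₆⁺/Γ₆ ≅ (ℤ/2ℤ)²` … the quotient `X₆⁺`»). [cite: BayerTravesa2007, §2]
* A. P. Ogg (1983), §2 (2) («`W ≃ C₂^r`») and p. 284 (fixed points of `w(m)`). [cite: Ogg1983RealPoints, §2]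

## Scope (honest)

Theorems only — no definitions, no named facts, no instances; `Γ₆⁺`-equivalence is the inline relation of §1 and the
quotients are bare `Quot`s. The identification of `Pt(t)/Γ₆⁺` with the points of an algebraic model of `X₆⁺` is not
formalised.
-/

noncomputable section

set_option maxSynthPendingDepth 3

open Quaternion Function

namespace Literature.Geometry.Kaehler.ComplexTorus.QuaternionType

/-! ## §0 Helpers -/

section Helpers

/-- `ρ(1)` acts trivially. [folklore] -/
private theorem moebius_rho_castQ_one₄ (τ : ℂ) :
    moebius (rho (-1) 3 (by norm_num) (castQ (-1) 3 (1 : ℍ[ℚ,((-1 : ℤ) : ℚ),((3 : ℤ) : ℚ)]))) τ = τ := by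
  rw [castQ_one, map_one, moebius_apply]
  simp

/-- `ρ(wv) = ρ(w) ∘ ρ(v)` on `ℌ` for positive norms. [folklore] -/
private theorem moebius_rho_castQ_mul₄ {v w : ℍ[ℚ,((-1 : ℤ) : ℚ),((3 : ℤ) : ℚ)]} (hv : 0 < (v * star v).re)
    (hw : 0 < (w * star w).re) {τ : ℂ} (hτ : 0 < τ.im) :
    moebius (rho (-1) 3 (by norm_num) (castQ (-1) 3 (w * v))) τ =
      moebius (rho (-1) 3 (by norm_num) (castQ (-1) 3 w)) (moebius (rho (-1) 3 (by norm_num) (castQ (-1) 3 v)) τ) := by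
  rw [castQ_mul, map_mul]
  exact moebius_mul_of_det_pos (det_rho_castQ_pos _ hw) (det_rho_castQ_pos _ hv) (UpperHalfPlane.mk τ hτ)

/-- The product of two non-zero quaternions of `(−1,3)_ℚ` is non-zero. [folklore] -/
private theorem mul_ne_zero₄ {g h : ℍ[ℚ,((-1 : ℤ) : ℚ),((3 : ℤ) : ℚ)]} (hg : g ≠ 0) (hh : h ≠ 0) : g * h ≠ 0 := by
  intro h0
  have e := re_mul_mul_star_mul g h
  rw [h0, zero_mul, QuaternionAlgebra.re_zero] at e
  exact mul_ne_zero (norm_ne_zero_of_ne_zero hg) (norm_ne_zero_of_ne_zero hh) e.symm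

/-- `gO₆ ⊆ O₆g ⟹ ḡO₆ ⊆ O₆ḡ` (`N(O₆)` exhausted). [folklore] -/
private theorem normalises_star_of_left₄ {g : ℍ[ℚ,((-1 : ℤ) : ℚ),((3 : ℤ) : ℚ)]} (hg0 : g ≠ 0)
    (hL : (∀ a : ℍ[ℚ,((-1 : ℤ) : ℚ),((3 : ℤ) : ℚ)], (a ∈ order (-1) 3 ∨ a - ⟨1/2, 1/2, 1/2, -1/2⟩ ∈ order (-1) 3) →
      ∃ b : ℍ[ℚ,((-1 : ℤ) : ℚ),((3 : ℤ) : ℚ)], (b ∈ order (-1) 3 ∨ b - ⟨1/2, 1/2, 1/2, -1/2⟩ ∈ order (-1) 3) ∧ g * a = b * g)) :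
    ∀ a : ℍ[ℚ,((-1 : ℤ) : ℚ),((3 : ℤ) : ℚ)], (a ∈ order (-1) 3 ∨ a - ⟨1/2, 1/2, 1/2, -1/2⟩ ∈ order (-1) 3) →
      ∃ b : ℍ[ℚ,((-1 : ℤ) : ℚ),((3 : ℤ) : ℚ)], (b ∈ order (-1) 3 ∨ b - ⟨1/2, 1/2, 1/2, -1/2⟩ ∈ order (-1) 3) ∧
        star g * a = b * star g := by
  obtain ⟨q, v, k, l, -, hv, h1, -, -, hg⟩ := (normalises_maxOrder_iff_exists' hg0).1 hL
  have hR := (normalises_of_eq_smul_unit_mul_atkinLehner hv h1 k l hg).2.2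
  intro a ha
  obtain ⟨c, hc, e⟩ := hR (star a) (star_maxOrder ha)
  refine ⟨star c, star_maxOrder hc, ?_⟩
  have e' := congrArg star e
  rwa [star_mul, star_star, star_mul] at e'

/-- **Four sheets**: `M` an involution, `A q, M q, M(A q) ≠ q`, `f` onto, `A`- and `M`-invariant, with fibres
`{q, A q, M q, M(A q)}` ⟹ `|Q| = 4·|Q′|`. [folklore] -/
private theorem card_eq_four_mul_card_of_four_sheets₄ {Q Q' : Type*} [Finite Q] (A M : Q → Q)
    (hMM : ∀ q, M (M q) = q) (hA : ∀ q, A q ≠ q) (hM : ∀ q, M q ≠ q) (hAM : ∀ q, M (A q) ≠ q)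
    (f : Q → Q') (hf : Function.Surjective f) (hfA : ∀ q, f (A q) = f q) (hfM : ∀ q, f (M q) = f q)
    (hff : ∀ q₁ q₂, f q₁ = f q₂ → q₁ = q₂ ∨ q₁ = A q₂ ∨ q₁ = M q₂ ∨ q₁ = M (A q₂)) :
    Nat.card Q = 4 * Nat.card Q' := by
  haveI : Finite Q' := Finite.of_surjective f hf
  set s := Function.surjInv hf with hs
  have hfs : ∀ q', f (s q') = q' := Function.surjInv_eq hf
  have key : Function.Bijective
      (Sum.elim (Sum.elim s (A ∘ s)) (Sum.elim (M ∘ s) (M ∘ A ∘ s)) : (Q' ⊕ Q') ⊕ (Q' ⊕ Q') → Q) := by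
    constructor
    · rintro ((a | a) | (a | a)) ((a' | a') | (a' | a')) h <;>
        have h' := congrArg f h <;>
        simp only [Sum.elim_inl, Sum.elim_inr, Function.comp_apply, hfs, hfA, hfM] at h h' <;>
        subst h'
      · rfl
      · exact absurd h.symm (hA _)
      · exact absurd h.symm (hM _)
      · exact absurd h.symm (hAM _)
      · exact absurd h (hA _)
      · rfl
      · exact absurd (show M (A (s a)) = s a by rw [h, hMM]) (hAM _)
      · exact absurd h.symm (hM _)
      · exact absurd h (hM _)
      · exact absurd (show M (A (s a)) = s a by rw [← h, hMM]) (hAM _)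
      · rfl
      · have h2 : s a = A (s a) := by simpa only [hMM] using congrArg M h
        exact absurd h2.symm (hA _)
      · exact absurd h (hAM _)
      · exact absurd h (hM _)
      · have h2 : A (s a) = s a := by simpa only [hMM] using congrArg M h
        exact absurd h2 (hA _)
      · rfl
    · intro q
      rcases hff q (s (f q)) (by rw [hfs]) with h | h | h | h
      · exact ⟨Sum.inl (Sum.inl (f q)), h.symm⟩
      · exact ⟨Sum.inl (Sum.inr (f q)), h.symm⟩
      · exact ⟨Sum.inr (Sum.inl (f q)), h.symm⟩
      · exact ⟨Sum.inr (Sum.inr (f q)), h.symm⟩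
  rw [← Nat.card_eq_of_bijective _ key, Nat.card_sum, Nat.card_sum]
  ring

/-- **`ρ(W)` preserves `Pt(t)`** for `W` of positive norm normalising `𝔬` on the left: `ρ(W)τ` is fixed by
`y = Wx̂W⁻¹ ∈ 𝔬`, `tr y = 0`, `nr y = t`. [folklore] -/
private theorem moebius_mem_specialPoints {t : ℤ} {W : ℍ[ℚ,((-1 : ℤ) : ℚ),((3 : ℤ) : ℚ)]} {n : ℚ} (hWn : (W * star W).re = n) (hn : 0 < n)
    (hLo : ∀ z ∈ order (-1) 3, ∃ y ∈ order (-1) 3, W * z = y * W)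
    {τ : ℂ} (hτ : 0 < τ.im) {x : ℍ[ℚ,((-1 : ℤ) : ℚ),((3 : ℤ) : ℚ)]} (hx : x ∈ order (-1) 3) (hre : x.re = 0) (hxn : (x * star x).re = t)
    (hfix : moebius (rho (-1) 3 (by norm_num) (castQ (-1) 3 x)) τ = τ) :
    0 < (moebius (rho (-1) 3 (by norm_num) (castQ (-1) 3 W)) τ).im ∧
    ∃ y : ℍ[ℚ,((-1 : ℤ) : ℚ),((3 : ℤ) : ℚ)], y ∈ order (-1) 3 ∧ y.re = 0 ∧ (y * star y).re = t ∧
      moebius (rho (-1) 3 (by norm_num) (castQ (-1) 3 y)) (moebius (rho (-1) 3 (by norm_num) (castQ (-1) 3 W)) τ) =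
        moebius (rho (-1) 3 (by norm_num) (castQ (-1) 3 W)) τ := by
  have h3 : (0 : ℤ) < 3 := by norm_num
  have hWpos : 0 < (W * star W).re := by rw [hWn]; exact hn
  refine ⟨im_moebius_rho_pos h3 hWpos hτ, ?_⟩
  obtain ⟨y, hy, e⟩ := hLo x hx
  -- `W x W̄ = n • y`
  have e2 : W * x * star W = (n : ℚ) • y := by
    rw [e, mul_assoc, QuaternionAlgebra.mul_star_eq_coe, hWn, QuaternionAlgebra.mul_coe_eq_smul]
  have hyre : y.re = 0 := by
    have h0 := congrArg QuaternionAlgebra.re e2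
    rw [re_conj_eq, hWn, hre, mul_zero, QuaternionAlgebra.re_smul, smul_eq_mul] at h0
    rcases mul_eq_zero.1 h0.symm with h1 | h1
    · exact absurd h1 hn.ne'
    · exact h1
  obtain ⟨⟨p₁, p₂, p₃⟩, hpe, hpQ⟩ := exists_eq_mk_of_mem_order_re_zero hy hyre
  dsimp only at hpe hpQ
  have hyn : (y * star y).re = t := by
    have hN := norm_conj_eq W x
    rw [e2, hWn, hxn, hpe, QuaternionAlgebra.smul_mk, smul_zero] at hN
    simp only [smul_eq_mul] at hN
    rw [pureVec_norm] at hN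
    rw [hpe, pureVec_norm]
    have hn2 : (n : ℚ) ^ 2 ≠ 0 := pow_ne_zero 2 hn.ne'
    have : n ^ 2 * ((p₁ : ℚ) ^ 2 - 3 * (p₂ : ℚ) ^ 2 - 3 * (p₃ : ℚ) ^ 2) = n ^ 2 * (t : ℚ) := by
      rw [← hN]; ring
    exact mul_left_cancel₀ hn2 this
  refine ⟨y, hy, hyre, hyn, ?_⟩
  have hf := moebius_conj_fixed_of_im_ne_zero h3 (ε := W) (x := x) hWpos.ne' hτ.ne' hfix
  rw [e2, moebius_rho_castQ_smul hn.ne'] at hf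
  exact hf

end Helpers

/-! ## §1 `Γ₆⁺`-equivalence of points -/

section Plus

/-- **`Γ₆⁺`-EQUIVALENCE IS AN EQUIVALENCE RELATION on `Pt(t)`**, `Γ₆⁺ = {g ≠ 0 : gO₆ ⊆ O₆g, nr g > 0}` acting through
`ρ` (inverse via `ḡ`: `ρ(ḡ)ρ(g) = id` on `ℌ`). [cite: BayerTravesa2007, §2 («`Γ₆⁺`»)] [cite: VignerasLNM800, Ch. IV §3 B] -/
theorem specialPointsPlus_equivalence (t : ℤ) :
    Equivalence (fun p q : {τ : ℂ // 0 < τ.im ∧ ∃ x : ℍ[ℚ,((-1 : ℤ) : ℚ),((3 : ℤ) : ℚ)],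
        x ∈ order (-1) 3 ∧ x.re = 0 ∧ (x * star x).re = t ∧ moebius (rho (-1) 3 (by norm_num) (castQ (-1) 3 x)) τ = τ} ↦
      ∃ g : ℍ[ℚ,((-1 : ℤ) : ℚ),((3 : ℤ) : ℚ)], g ≠ 0 ∧
        (∀ a : ℍ[ℚ,((-1 : ℤ) : ℚ),((3 : ℤ) : ℚ)], (a ∈ order (-1) 3 ∨ a - ⟨1/2, 1/2, 1/2, -1/2⟩ ∈ order (-1) 3) →
          ∃ b : ℍ[ℚ,((-1 : ℤ) : ℚ),((3 : ℤ) : ℚ)], (b ∈ order (-1) 3 ∨ b - ⟨1/2, 1/2, 1/2, -1/2⟩ ∈ order (-1) 3) ∧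
            g * a = b * g) ∧
        0 < (g * star g).re ∧ moebius (rho (-1) 3 (by norm_num) (castQ (-1) 3 g)) p.1 = q.1) where
  refl p := ⟨1, one_ne_zero, fun a ha ↦ ⟨a, ha, by rw [one_mul, mul_one]⟩,
    by rw [star_one, mul_one, QuaternionAlgebra.re_one]; exact one_pos, moebius_rho_castQ_one₄ _⟩
  symm := by
    rintro p q ⟨g, hg0, hL, hn, h⟩
    refine ⟨star g, star_ne_zero.2 hg0, normalises_star_of_left₄ hg0 hL, by rw [star_star, star_comm_self' g]; exact hn,
      ?_⟩
    rw [← h]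
    exact moebius_rho_star_moebius_rho (by norm_num) hn (UpperHalfPlane.mk p.1 p.2.1)
  trans := by
    rintro p q r ⟨g, hg0, hgL, hgn, hg⟩ ⟨h, hh0, hhL, hhn, hh⟩
    refine ⟨h * g, mul_ne_zero₄ hh0 hg0, fun a ha ↦ ?_,
      by rw [re_mul_mul_star_mul]; exact mul_pos hhn hgn, ?_⟩
    · obtain ⟨b, hb, eb⟩ := hgL a ha
      obtain ⟨c, hc, ec⟩ := hhL b hb
      exact ⟨c, hc, by rw [mul_assoc, eb, ← mul_assoc, ec, mul_assoc]⟩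
    · rw [moebius_rho_castQ_mul₄ hgn hhn p.2.1, hg, hh]

/-- Equality of `Γ₆⁺`-classes of points iff `Γ₆⁺`-equivalent. [cite: BayerTravesa2007, §2] -/
theorem specialPointsPlus_mk_eq_iff (t : ℤ) (p q : {τ : ℂ // 0 < τ.im ∧ ∃ x : ℍ[ℚ,((-1 : ℤ) : ℚ),((3 : ℤ) : ℚ)],
        x ∈ order (-1) 3 ∧ x.re = 0 ∧ (x * star x).re = t ∧ moebius (rho (-1) 3 (by norm_num) (castQ (-1) 3 x)) τ = τ}) :
    Quot.mk (fun p q : {τ : ℂ // 0 < τ.im ∧ ∃ x : ℍ[ℚ,((-1 : ℤ) : ℚ),((3 : ℤ) : ℚ)],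
        x ∈ order (-1) 3 ∧ x.re = 0 ∧ (x * star x).re = t ∧ moebius (rho (-1) 3 (by norm_num) (castQ (-1) 3 x)) τ = τ} ↦
      ∃ g : ℍ[ℚ,((-1 : ℤ) : ℚ),((3 : ℤ) : ℚ)], g ≠ 0 ∧
        (∀ a : ℍ[ℚ,((-1 : ℤ) : ℚ),((3 : ℤ) : ℚ)], (a ∈ order (-1) 3 ∨ a - ⟨1/2, 1/2, 1/2, -1/2⟩ ∈ order (-1) 3) →
          ∃ b : ℍ[ℚ,((-1 : ℤ) : ℚ),((3 : ℤ) : ℚ)], (b ∈ order (-1) 3 ∨ b - ⟨1/2, 1/2, 1/2, -1/2⟩ ∈ order (-1) 3) ∧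
            g * a = b * g) ∧
        0 < (g * star g).re ∧ moebius (rho (-1) 3 (by norm_num) (castQ (-1) 3 g)) p.1 = q.1) p = Quot.mk _ q ↔
      ∃ g : ℍ[ℚ,((-1 : ℤ) : ℚ),((3 : ℤ) : ℚ)], g ≠ 0 ∧
        (∀ a : ℍ[ℚ,((-1 : ℤ) : ℚ),((3 : ℤ) : ℚ)], (a ∈ order (-1) 3 ∨ a - ⟨1/2, 1/2, 1/2, -1/2⟩ ∈ order (-1) 3) →
          ∃ b : ℍ[ℚ,((-1 : ℤ) : ℚ),((3 : ℤ) : ℚ)], (b ∈ order (-1) 3 ∨ b - ⟨1/2, 1/2, 1/2, -1/2⟩ ∈ order (-1) 3) ∧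
            g * a = b * g) ∧
        0 < (g * star g).re ∧ moebius (rho (-1) 3 (by norm_num) (castQ (-1) 3 g)) p.1 = q.1 := by
  rw [Quot.eq]
  exact (specialPointsPlus_equivalence t).eqvGen_iff

end Plus

/-! ## §2 `#(Pt(t)/Γ₆) = 4·#(Pt(t)/Γ₆⁺)` for `t ≡ 19 (mod 24)` -/

section Count

/-- **`#(Pt(t)/Γ₆) = 4·#(Pt(t)/Γ₆⁺)` for `t > 0`, `3 ∤ t`, `t ≡ 3 (mod 4)`**: `W ≅ (ℤ/2ℤ)²`, generated by `ρ(μ)` and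
`ρ(w₂)` on `Pt(t)/Γ₆`, acts freely (`…XSixAtkinLehnerMovesSpecialPoints`) with orbits the `Γ₆⁺`-classes. [cite: KudlaRapoportYang2006, §3.4 Remark 3.4.7 and (3.4.11)] [cite: BayerTravesa2007, §2] [cite: Ogg1983RealPoints, §2] -/
theorem card_specialPoints_eq_four_mul_card_specialPointsPlus {t : ℤ} (ht : 0 < t) (h3 : ¬ (3 : ℤ) ∣ t)
    (h4 : t % 4 = 3) :
    Nat.card (Quot (fun p q : {τ : ℂ // 0 < τ.im ∧ ∃ x : ℍ[ℚ,((-1 : ℤ) : ℚ),((3 : ℤ) : ℚ)],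
        x ∈ order (-1) 3 ∧ x.re = 0 ∧ (x * star x).re = t ∧ moebius (rho (-1) 3 (by norm_num) (castQ (-1) 3 x)) τ = τ} ↦
      ∃ v : ℍ[ℚ,((-1 : ℤ) : ℚ),((3 : ℤ) : ℚ)], (v ∈ order (-1) 3 ∨ v - ⟨1/2, 1/2, 1/2, -1/2⟩ ∈ order (-1) 3) ∧
        v * star v = 1 ∧ moebius (rho (-1) 3 (by norm_num) (castQ (-1) 3 v)) p.1 = q.1)) =
    4 * Nat.card (Quot (fun p q : {τ : ℂ // 0 < τ.im ∧ ∃ x : ℍ[ℚ,((-1 : ℤ) : ℚ),((3 : ℤ) : ℚ)],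
        x ∈ order (-1) 3 ∧ x.re = 0 ∧ (x * star x).re = t ∧ moebius (rho (-1) 3 (by norm_num) (castQ (-1) 3 x)) τ = τ} ↦
      ∃ g : ℍ[ℚ,((-1 : ℤ) : ℚ),((3 : ℤ) : ℚ)], g ≠ 0 ∧
        (∀ a : ℍ[ℚ,((-1 : ℤ) : ℚ),((3 : ℤ) : ℚ)], (a ∈ order (-1) 3 ∨ a - ⟨1/2, 1/2, 1/2, -1/2⟩ ∈ order (-1) 3) →
          ∃ b : ℍ[ℚ,((-1 : ℤ) : ℚ),((3 : ℤ) : ℚ)], (b ∈ order (-1) 3 ∨ b - ⟨1/2, 1/2, 1/2, -1/2⟩ ∈ order (-1) 3) ∧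
            g * a = b * g) ∧
        0 < (g * star g).re ∧ moebius (rho (-1) 3 (by norm_num) (castQ (-1) 3 g)) p.1 = q.1)) := by
  set S : {τ : ℂ // 0 < τ.im ∧ ∃ x : ℍ[ℚ,((-1 : ℤ) : ℚ),((3 : ℤ) : ℚ)],
        x ∈ order (-1) 3 ∧ x.re = 0 ∧ (x * star x).re = t ∧ moebius (rho (-1) 3 (by norm_num) (castQ (-1) 3 x)) τ = τ} →
      {τ : ℂ // 0 < τ.im ∧ ∃ x : ℍ[ℚ,((-1 : ℤ) : ℚ),((3 : ℤ) : ℚ)],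
        x ∈ order (-1) 3 ∧ x.re = 0 ∧ (x * star x).re = t ∧ moebius (rho (-1) 3 (by norm_num) (castQ (-1) 3 x)) τ = τ} → Prop :=
    fun p q ↦ ∃ v : ℍ[ℚ,((-1 : ℤ) : ℚ),((3 : ℤ) : ℚ)], (v ∈ order (-1) 3 ∨ v - ⟨1/2, 1/2, 1/2, -1/2⟩ ∈ order (-1) 3) ∧
        v * star v = 1 ∧ moebius (rho (-1) 3 (by norm_num) (castQ (-1) 3 v)) p.1 = q.1 with hS
  set P : {τ : ℂ // 0 < τ.im ∧ ∃ x : ℍ[ℚ,((-1 : ℤ) : ℚ),((3 : ℤ) : ℚ)],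
        x ∈ order (-1) 3 ∧ x.re = 0 ∧ (x * star x).re = t ∧ moebius (rho (-1) 3 (by norm_num) (castQ (-1) 3 x)) τ = τ} →
      {τ : ℂ // 0 < τ.im ∧ ∃ x : ℍ[ℚ,((-1 : ℤ) : ℚ),((3 : ℤ) : ℚ)],
        x ∈ order (-1) 3 ∧ x.re = 0 ∧ (x * star x).re = t ∧ moebius (rho (-1) 3 (by norm_num) (castQ (-1) 3 x)) τ = τ} → Prop :=
    fun p q ↦ ∃ g : ℍ[ℚ,((-1 : ℤ) : ℚ),((3 : ℤ) : ℚ)], g ≠ 0 ∧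
        (∀ a : ℍ[ℚ,((-1 : ℤ) : ℚ),((3 : ℤ) : ℚ)], (a ∈ order (-1) 3 ∨ a - ⟨1/2, 1/2, 1/2, -1/2⟩ ∈ order (-1) 3) →
          ∃ b : ℍ[ℚ,((-1 : ℤ) : ℚ),((3 : ℤ) : ℚ)], (b ∈ order (-1) 3 ∨ b - ⟨1/2, 1/2, 1/2, -1/2⟩ ∈ order (-1) 3) ∧
            g * a = b * g) ∧
        0 < (g * star g).re ∧ moebius (rho (-1) 3 (by norm_num) (castQ (-1) 3 g)) p.1 = q.1 with hP
  haveI : Finite (Quot S) := finite_specialPoints ht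
  have hE : Equivalence S := specialPoints_equivalence t
  have hEP : Equivalence P := specialPointsPlus_equivalence t
  have hiff : ∀ p q, Quot.mk S p = Quot.mk S q ↔ S p q := specialPoints_mk_eq_iff t
  have hiffP : ∀ p q, Quot.mk P p = Quot.mk P q ↔ P p q := specialPointsPlus_mk_eq_iff t
  have h3' : (0 : ℤ) < 3 := by norm_num
  -- the two generators `μ` (for `A`) and `w₂` (for `M`): norms, units, normalising data
  have h1O : ((1 : ℍ[ℚ,((-1 : ℤ) : ℚ),((3 : ℤ) : ℚ)]) ∈ order (-1) 3 ∨ (1 : ℍ[ℚ,((-1 : ℤ) : ℚ),((3 : ℤ) : ℚ)]) - ⟨1/2, 1/2, 1/2, -1/2⟩ ∈ order (-1) 3) := Or.inl (Subring.one_mem _)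
  have h11 : (1 : ℍ[ℚ,((-1 : ℤ) : ℚ),((3 : ℤ) : ℚ)]) * star 1 = 1 ∨ (1 : ℍ[ℚ,((-1 : ℤ) : ℚ),((3 : ℤ) : ℚ)]) * star 1 = -1 := Or.inl (by rw [star_one, mul_one])
  have hNm := normalises_of_eq_smul_unit_mul_atkinLehner (g := ⟨3, 0, 1, 1⟩) (q := 1) h1O h11 0 1
    (by rw [pow_zero, pow_one, one_mul, one_mul, one_smul])
  have hNw := normalises_of_eq_smul_unit_mul_atkinLehner (g := ⟨1, 1, 0, 0⟩) (q := 1) h1O h11 1 0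
    (by rw [pow_one, pow_zero, mul_one, one_mul, one_smul])
  have hw6 : (⟨1, 1, 0, 0⟩ : ℍ[ℚ,((-1 : ℤ) : ℚ),((3 : ℤ) : ℚ)]) * ⟨3, 0, 1, 1⟩ = ⟨3, 3, 0, 2⟩ := (pureVec_mul_w6 0 0 0).1
  have hnm : ((⟨3, 0, 1, 1⟩ : ℍ[ℚ,((-1 : ℤ) : ℚ),((3 : ℤ) : ℚ)]) * star ⟨3, 0, 1, 1⟩).re = 3 := by
    rw [QuaternionAlgebra.star_mk, QuaternionAlgebra.mk_mul_mk]; norm_num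
  have hnw : ((⟨1, 1, 0, 0⟩ : ℍ[ℚ,((-1 : ℤ) : ℚ),((3 : ℤ) : ℚ)]) * star ⟨1, 1, 0, 0⟩).re = 2 := by
    rw [QuaternionAlgebra.star_mk, QuaternionAlgebra.mk_mul_mk]; norm_num
  have hm0 : (⟨3, 0, 1, 1⟩ : ℍ[ℚ,((-1 : ℤ) : ℚ),((3 : ℤ) : ℚ)]) ≠ 0 := fun h ↦ by simpa using congrArg QuaternionAlgebra.re h
  have hw0 : (⟨1, 1, 0, 0⟩ : ℍ[ℚ,((-1 : ℤ) : ℚ),((3 : ℤ) : ℚ)]) ≠ 0 := fun h ↦ by simpa using congrArg QuaternionAlgebra.re h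
  -- the maps on points
  have memA : ∀ p : {τ : ℂ // 0 < τ.im ∧ ∃ x : ℍ[ℚ,((-1 : ℤ) : ℚ),((3 : ℤ) : ℚ)],
        x ∈ order (-1) 3 ∧ x.re = 0 ∧ (x * star x).re = t ∧ moebius (rho (-1) 3 (by norm_num) (castQ (-1) 3 x)) τ = τ}, 0 < (moebius (rho (-1) 3 (by norm_num) (castQ (-1) 3 (⟨3, 0, 1, 1⟩ : ℍ[ℚ,((-1 : ℤ) : ℚ),((3 : ℤ) : ℚ)]))) p.1).im ∧
      ∃ y : ℍ[ℚ,((-1 : ℤ) : ℚ),((3 : ℤ) : ℚ)], y ∈ order (-1) 3 ∧ y.re = 0 ∧ (y * star y).re = t ∧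
        moebius (rho (-1) 3 (by norm_num) (castQ (-1) 3 y))
          (moebius (rho (-1) 3 (by norm_num) (castQ (-1) 3 (⟨3, 0, 1, 1⟩ : ℍ[ℚ,((-1 : ℤ) : ℚ),((3 : ℤ) : ℚ)]))) p.1) =
        moebius (rho (-1) 3 (by norm_num) (castQ (-1) 3 (⟨3, 0, 1, 1⟩ : ℍ[ℚ,((-1 : ℤ) : ℚ),((3 : ℤ) : ℚ)]))) p.1 := by
    intro p
    obtain ⟨x, hx, hre, hxn, hfix⟩ := p.2.2
    exact moebius_mem_specialPoints hnm three_pos hNm.1.1 p.2.1 hx hre hxn hfix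
  have memM : ∀ p : {τ : ℂ // 0 < τ.im ∧ ∃ x : ℍ[ℚ,((-1 : ℤ) : ℚ),((3 : ℤ) : ℚ)],
        x ∈ order (-1) 3 ∧ x.re = 0 ∧ (x * star x).re = t ∧ moebius (rho (-1) 3 (by norm_num) (castQ (-1) 3 x)) τ = τ}, 0 < (moebius (rho (-1) 3 (by norm_num) (castQ (-1) 3 (⟨1, 1, 0, 0⟩ : ℍ[ℚ,((-1 : ℤ) : ℚ),((3 : ℤ) : ℚ)]))) p.1).im ∧
      ∃ y : ℍ[ℚ,((-1 : ℤ) : ℚ),((3 : ℤ) : ℚ)], y ∈ order (-1) 3 ∧ y.re = 0 ∧ (y * star y).re = t ∧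
        moebius (rho (-1) 3 (by norm_num) (castQ (-1) 3 y))
          (moebius (rho (-1) 3 (by norm_num) (castQ (-1) 3 (⟨1, 1, 0, 0⟩ : ℍ[ℚ,((-1 : ℤ) : ℚ),((3 : ℤ) : ℚ)]))) p.1) =
        moebius (rho (-1) 3 (by norm_num) (castQ (-1) 3 (⟨1, 1, 0, 0⟩ : ℍ[ℚ,((-1 : ℤ) : ℚ),((3 : ℤ) : ℚ)]))) p.1 := by
    intro p
    obtain ⟨x, hx, hre, hxn, hfix⟩ := p.2.2
    exact moebius_mem_specialPoints hnw two_pos hNw.1.1 p.2.1 hx hre hxn hfix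
  set aA : {τ : ℂ // 0 < τ.im ∧ ∃ x : ℍ[ℚ,((-1 : ℤ) : ℚ),((3 : ℤ) : ℚ)],
        x ∈ order (-1) 3 ∧ x.re = 0 ∧ (x * star x).re = t ∧ moebius (rho (-1) 3 (by norm_num) (castQ (-1) 3 x)) τ = τ} →
      {τ : ℂ // 0 < τ.im ∧ ∃ x : ℍ[ℚ,((-1 : ℤ) : ℚ),((3 : ℤ) : ℚ)],
        x ∈ order (-1) 3 ∧ x.re = 0 ∧ (x * star x).re = t ∧ moebius (rho (-1) 3 (by norm_num) (castQ (-1) 3 x)) τ = τ} :=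
    fun p ↦ ⟨moebius (rho (-1) 3 (by norm_num) (castQ (-1) 3 (⟨3, 0, 1, 1⟩ : ℍ[ℚ,((-1 : ℤ) : ℚ),((3 : ℤ) : ℚ)]))) p.1, memA p⟩ with haA
  set aM : {τ : ℂ // 0 < τ.im ∧ ∃ x : ℍ[ℚ,((-1 : ℤ) : ℚ),((3 : ℤ) : ℚ)],
        x ∈ order (-1) 3 ∧ x.re = 0 ∧ (x * star x).re = t ∧ moebius (rho (-1) 3 (by norm_num) (castQ (-1) 3 x)) τ = τ} →
      {τ : ℂ // 0 < τ.im ∧ ∃ x : ℍ[ℚ,((-1 : ℤ) : ℚ),((3 : ℤ) : ℚ)],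
        x ∈ order (-1) 3 ∧ x.re = 0 ∧ (x * star x).re = t ∧ moebius (rho (-1) 3 (by norm_num) (castQ (-1) 3 x)) τ = τ} :=
    fun p ↦ ⟨moebius (rho (-1) 3 (by norm_num) (castQ (-1) 3 (⟨1, 1, 0, 0⟩ : ℍ[ℚ,((-1 : ℤ) : ℚ),((3 : ℤ) : ℚ)]))) p.1, memM p⟩ with haM
  -- compatibility with `Γ₆`-equivalence: `ρ(W)ρ(v) = ρ(v′)ρ(W)`, `Wv = v′W`
  have compat : ∀ (W : ℍ[ℚ,((-1 : ℤ) : ℚ),((3 : ℤ) : ℚ)]) (aW : {τ : ℂ // 0 < τ.im ∧ ∃ x : ℍ[ℚ,((-1 : ℤ) : ℚ),((3 : ℤ) : ℚ)],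
        x ∈ order (-1) 3 ∧ x.re = 0 ∧ (x * star x).re = t ∧ moebius (rho (-1) 3 (by norm_num) (castQ (-1) 3 x)) τ = τ} →
      {τ : ℂ // 0 < τ.im ∧ ∃ x : ℍ[ℚ,((-1 : ℤ) : ℚ),((3 : ℤ) : ℚ)],
        x ∈ order (-1) 3 ∧ x.re = 0 ∧ (x * star x).re = t ∧ moebius (rho (-1) 3 (by norm_num) (castQ (-1) 3 x)) τ = τ}),
      0 < (W * star W).re →
      (∀ a : ℍ[ℚ,((-1 : ℤ) : ℚ),((3 : ℤ) : ℚ)], (a ∈ order (-1) 3 ∨ a - ⟨1/2, 1/2, 1/2, -1/2⟩ ∈ order (-1) 3) →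
        ∃ b : ℍ[ℚ,((-1 : ℤ) : ℚ),((3 : ℤ) : ℚ)], (b ∈ order (-1) 3 ∨ b - ⟨1/2, 1/2, 1/2, -1/2⟩ ∈ order (-1) 3) ∧ W * a = b * W) →
      (∀ p, (aW p).1 = moebius (rho (-1) 3 (by norm_num) (castQ (-1) 3 W)) p.1) →
      ∀ p q, S p q → S (aW p) (aW q) := by
    intro W aW hWpos hL haWp p q
    rintro ⟨v, hv, hv1, h⟩
    obtain ⟨v', hv', e⟩ := hL v hv
    have hvn : (v * star v).re = 1 := by rw [hv1, QuaternionAlgebra.re_one]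
    have hv'n : (v' * star v').re = 1 := by
      have e2 := re_mul_mul_star_mul W v
      have e3 := re_mul_mul_star_mul v' W
      rw [e, hvn, mul_one] at e2
      rw [e2] at e3
      have e4 : (1 : ℚ) * (W * star W).re = (v' * star v').re * (W * star W).re := by rw [one_mul]; exact e3
      exact (mul_right_cancel₀ hWpos.ne' e4).symm
    refine ⟨v', hv', mul_star_eq_one_of_re hv'n, ?_⟩
    rw [haWp, haWp, ← moebius_rho_castQ_mul₄ hWpos (by rw [hv'n]; exact one_pos) p.2.1, ← e,
      moebius_rho_castQ_mul₄ (by rw [hvn]; exact one_pos) hWpos p.2.1, h]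
  have cA : ∀ p q, S p q → S (aA p) (aA q) := compat ⟨3, 0, 1, 1⟩ aA (by rw [hnm]; norm_num) hNm.2.1 (fun _ ↦ rfl)
  have cM : ∀ p q, S p q → S (aM p) (aM q) := compat ⟨1, 1, 0, 0⟩ aM (by rw [hnw]; norm_num) hNw.2.1 (fun _ ↦ rfl)
  -- `Γ₆`-equivalence implies `Γ₆⁺`-equivalence
  have hSP : ∀ p q, S p q → P p q := by
    rintro p q ⟨v, hv, hv1, h⟩
    have hvn : (v * star v).re = 1 := by rw [hv1, QuaternionAlgebra.re_one]
    refine ⟨v, fun h0 ↦ by rw [h0, zero_mul, QuaternionAlgebra.re_zero] at hvn; exact zero_ne_one hvn,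
      (normalises_of_eq_smul_unit_mul_atkinLehner (g := v) (q := 1) hv (Or.inl hv1) 0 0
      (by rw [pow_zero, pow_zero, mul_one, mul_one, one_smul])).2.1, by rw [hvn]; exact one_pos, h⟩
  -- a point of `Pt(t)` as an integer special vector fixing it
  have rep : ∀ p : {τ : ℂ // 0 < τ.im ∧ ∃ x : ℍ[ℚ,((-1 : ℤ) : ℚ),((3 : ℤ) : ℚ)],
        x ∈ order (-1) 3 ∧ x.re = 0 ∧ (x * star x).re = t ∧ moebius (rho (-1) 3 (by norm_num) (castQ (-1) 3 x)) τ = τ}, ∃ x : {x : ℤ × ℤ × ℤ // x.1 ^ 2 - 3 * x.2.1 ^ 2 - 3 * x.2.2 ^ 2 = t},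
      moebius (rho (-1) 3 (by norm_num) (castQ (-1) 3 (⟨0, x.1.1, x.1.2.1, x.1.2.2⟩ : ℍ[ℚ,((-1 : ℤ) : ℚ),((3 : ℤ) : ℚ)]))) p.1 = p.1 := by
    intro p
    obtain ⟨x, hx, hre, hxn, hfix⟩ := p.2.2
    obtain ⟨⟨p₁, p₂, p₃⟩, hpe, hpQ⟩ := exists_eq_mk_of_mem_order_re_zero hx hre
    dsimp only at hpe hpQ
    rw [hxn] at hpQ
    have hQ : p₁ ^ 2 - 3 * p₂ ^ 2 - 3 * p₃ ^ 2 = t := by exact_mod_cast hpQ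
    refine ⟨⟨(p₁, p₂, p₃), hQ⟩, ?_⟩
    show moebius (rho (-1) 3 (by norm_num) (castQ (-1) 3 (⟨0, ((p₁ : ℤ) : ℚ), ((p₂ : ℤ) : ℚ), ((p₃ : ℤ) : ℚ)⟩ :
      ℍ[ℚ,((-1 : ℤ) : ℚ),((3 : ℤ) : ℚ)]))) p.1 = p.1
    rw [← hpe]; exact hfix
  refine card_eq_four_mul_card_of_four_sheets₄ (Quot.map aA cA) (Quot.map aM cM) ?_ ?_ ?_ ?_
    (Quot.lift (fun p ↦ Quot.mk P p) fun p q h ↦ (hiffP p q).2 (hSP p q h)) ?_ ?_ ?_ ?_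
  · -- `ρ(w₂)² = ρ(2i) = ρ(i)`, `i ∈ Γ₆`
    intro q
    induction q using Quot.ind with
    | _ p =>
      show Quot.mk S (aM (aM p)) = Quot.mk S p
      rw [hiff]
      refine ⟨star ⟨0, 1, 0, 0⟩, star_maxOrder (Or.inl ⟨![0, 1, 0, 0], by ext <;> simp [ofCoords]⟩),
        by rw [star_star, QuaternionAlgebra.star_mk, QuaternionAlgebra.mk_mul_mk]; ext <;> norm_num, ?_⟩
      show moebius (rho (-1) 3 (by norm_num) (castQ (-1) 3 (star (⟨0, 1, 0, 0⟩ : ℍ[ℚ,((-1 : ℤ) : ℚ),((3 : ℤ) : ℚ)]))))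
        (moebius (rho (-1) 3 (by norm_num) (castQ (-1) 3 (⟨1, 1, 0, 0⟩ : ℍ[ℚ,((-1 : ℤ) : ℚ),((3 : ℤ) : ℚ)])))
          (moebius (rho (-1) 3 (by norm_num) (castQ (-1) 3 (⟨1, 1, 0, 0⟩ : ℍ[ℚ,((-1 : ℤ) : ℚ),((3 : ℤ) : ℚ)]))) p.1)) = p.1
      have hsq : (⟨1, 1, 0, 0⟩ : ℍ[ℚ,((-1 : ℤ) : ℚ),((3 : ℤ) : ℚ)]) * ⟨1, 1, 0, 0⟩ = (2 : ℚ) • ⟨0, 1, 0, 0⟩ := by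
        rw [QuaternionAlgebra.mk_mul_mk, QuaternionAlgebra.smul_mk]; ext <;> norm_num
      have hi : 0 < ((⟨0, 1, 0, 0⟩ : ℍ[ℚ,((-1 : ℤ) : ℚ),((3 : ℤ) : ℚ)]) * star ⟨0, 1, 0, 0⟩).re := by
        rw [QuaternionAlgebra.star_mk, QuaternionAlgebra.mk_mul_mk]; norm_num
      rw [← moebius_rho_castQ_mul₄ (by rw [hnw]; norm_num) (by rw [hnw]; norm_num) p.2.1, hsq,
        moebius_rho_castQ_smul (by norm_num : (2 : ℚ) ≠ 0)]
      exact moebius_rho_star_moebius_rho h3' hi (UpperHalfPlane.mk p.1 p.2.1)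
  · -- `ρ(μ)` moves every class
    intro q
    induction q using Quot.ind with
    | _ p =>
      show Quot.mk S (aA p) ≠ Quot.mk S p
      rw [Ne, hiff]
      rintro ⟨v, hv, hv1, h⟩
      obtain ⟨x, hx⟩ := rep p
      exact atkinLehnerThree_moves_specialPoints ht h3 x p.2.1 hx hv hv1 h
  · -- `ρ(w₂)` moves every class
    intro q
    induction q using Quot.ind with
    | _ p =>
      show Quot.mk S (aM p) ≠ Quot.mk S p
      rw [Ne, hiff]
      rintro ⟨v, hv, hv1, h⟩
      obtain ⟨x, hx⟩ := rep p
      exact atkinLehnerTwo_moves_specialPoints ht h4 x p.2.1 hx hv hv1 h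
  · -- `ρ(w₂)ρ(μ) = ρ(w₆)` moves every class
    intro q
    induction q using Quot.ind with
    | _ p =>
      show Quot.mk S (aM (aA p)) ≠ Quot.mk S p
      rw [Ne, hiff]
      rintro ⟨v, hv, hv1, h⟩
      obtain ⟨x, hx⟩ := rep p
      have h' : moebius (rho (-1) 3 (by norm_num) (castQ (-1) 3 v))
          (moebius (rho (-1) 3 (by norm_num) (castQ (-1) 3 (⟨3, 3, 0, 2⟩ : ℍ[ℚ,((-1 : ℤ) : ℚ),((3 : ℤ) : ℚ)]))) p.1) = p.1 := by
        rw [← hw6, moebius_rho_castQ_mul₄ (by rw [hnm]; norm_num) (by rw [hnw]; norm_num) p.2.1]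
        exact h
      exact atkinLehnerSix_moves_specialPoints ht h3 x p.2.1 hx hv hv1 h'
  · -- onto
    intro q
    induction q using Quot.ind with
    | _ p => exact ⟨Quot.mk S p, rfl⟩
  · -- `P`-invariance under `ρ(μ)`
    intro q
    induction q using Quot.ind with
    | _ p =>
      show Quot.mk P (aA p) = Quot.mk P p
      refine ((hiffP p (aA p)).2 ⟨⟨3, 0, 1, 1⟩, hm0, hNm.2.1, by rw [hnm]; norm_num, rfl⟩).symm
  · intro q
    induction q using Quot.ind with
    | _ p =>
      show Quot.mk P (aM p) = Quot.mk P p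
      refine ((hiffP p (aM p)).2 ⟨⟨1, 1, 0, 0⟩, hw0, hNw.2.1, by rw [hnw]; norm_num, rfl⟩).symm
  · -- fibres: `Γ₆⁺ = ℚ_{>0}·Γ₆·{1, w₂, μ, w₂μ}`
    intro q₁ q₂
    induction q₁ using Quot.ind with
    | _ p₁ =>
      induction q₂ using Quot.ind with
      | _ p₂ =>
        intro h
        change Quot.mk P p₁ = Quot.mk P p₂ at h
        rw [hiffP] at h
        -- use the symmetric relation: `g` maps `p₂` to `p₁`
        obtain ⟨g, hg0, hL, hgn, hg⟩ := hEP.symm h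
        obtain ⟨q, v, k, l, hq, hv, h1, hk, hl, rfl⟩ := (normalises_maxOrder_iff_exists' hg0).1 hL
        -- `nr v = 1`
        have hWn : ∀ k l : ℕ, k ≤ 1 → l ≤ 1 →
            0 < (((⟨1, 1, 0, 0⟩ : ℍ[ℚ,((-1 : ℤ) : ℚ),((3 : ℤ) : ℚ)]) ^ k * ⟨3, 0, 1, 1⟩ ^ l) * star ((⟨1, 1, 0, 0⟩ : ℍ[ℚ,((-1 : ℤ) : ℚ),((3 : ℤ) : ℚ)]) ^ k * ⟨3, 0, 1, 1⟩ ^ l)).re := by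
          intro k l hk hl
          rcases Nat.le_one_iff_eq_zero_or_eq_one.1 hk with rfl | rfl <;>
            rcases Nat.le_one_iff_eq_zero_or_eq_one.1 hl with rfl | rfl
          · rw [pow_zero, pow_zero, mul_one, star_one, mul_one, QuaternionAlgebra.re_one]; exact one_pos
          · rw [pow_zero, pow_one, one_mul, hnm]; norm_num
          · rw [pow_one, pow_zero, mul_one, hnw]; norm_num
          · rw [pow_one, pow_one, re_mul_mul_star_mul, hnw, hnm]; norm_num
        have hv1 : v * star v = 1 := by
          rcases h1 with h1 | h1
          · exact h1
          · exfalso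
            have e1 : (q • (v * ⟨1, 1, 0, 0⟩ ^ k * ⟨3, 0, 1, 1⟩ ^ l) *
                star (q • (v * ⟨1, 1, 0, 0⟩ ^ k * ⟨3, 0, 1, 1⟩ ^ l))).re =
                q ^ 2 * ((v * star v).re * (((⟨1, 1, 0, 0⟩ : ℍ[ℚ,((-1 : ℤ) : ℚ),((3 : ℤ) : ℚ)]) ^ k * ⟨3, 0, 1, 1⟩ ^ l) *
                  star ((⟨1, 1, 0, 0⟩ : ℍ[ℚ,((-1 : ℤ) : ℚ),((3 : ℤ) : ℚ)]) ^ k * ⟨3, 0, 1, 1⟩ ^ l)).re) := by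
              rw [QuaternionAlgebra.star_smul, smul_mul_assoc, mul_smul_comm, ← mul_smul, QuaternionAlgebra.re_smul,
                smul_eq_mul, mul_assoc v, re_mul_mul_star_mul, pow_two]
            rw [e1, h1, QuaternionAlgebra.re_neg, QuaternionAlgebra.re_one] at hgn
            have := hWn k l hk hl
            nlinarith [sq_nonneg q, mul_pos (pow_pos hq 2) this]
        have hvn : (v * star v).re = 1 := by rw [hv1, QuaternionAlgebra.re_one]
        -- `ρ(g) p₂ = ρ(v)(ρ(W) p₂)`
        have hgW : moebius (rho (-1) 3 (by norm_num) (castQ (-1) 3 (q • (v * ⟨1, 1, 0, 0⟩ ^ k * ⟨3, 0, 1, 1⟩ ^ l)))) p₂.1 =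
            moebius (rho (-1) 3 (by norm_num) (castQ (-1) 3 v))
              (moebius (rho (-1) 3 (by norm_num) (castQ (-1) 3 ((⟨1, 1, 0, 0⟩ : ℍ[ℚ,((-1 : ℤ) : ℚ),((3 : ℤ) : ℚ)]) ^ k * ⟨3, 0, 1, 1⟩ ^ l))) p₂.1) := by
          rw [moebius_rho_castQ_smul hq.ne', mul_assoc, moebius_rho_castQ_mul₄ (hWn k l hk hl) (by rw [hvn]; exact one_pos) p₂.2.1]
        rw [hgW] at hg
        rcases Nat.le_one_iff_eq_zero_or_eq_one.1 hk with rfl | rfl <;>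
          rcases Nat.le_one_iff_eq_zero_or_eq_one.1 hl with rfl | rfl
        · -- `W = 1`
          left
          rw [hiff]
          refine hE.symm ⟨v, hv, hv1, ?_⟩
          rw [pow_zero, pow_zero, mul_one, moebius_rho_castQ_one₄] at hg
          exact hg
        · -- `W = μ`: `p₁ ∼ ρ(μ)p₂`
          right; left
          show Quot.mk S p₁ = Quot.mk S (aA p₂)
          rw [hiff]
          refine hE.symm ⟨v, hv, hv1, ?_⟩
          rw [pow_zero, pow_one, one_mul] at hg
          exact hg
        · -- `W = w₂`
          right; right; left
          show Quot.mk S p₁ = Quot.mk S (aM p₂)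
          rw [hiff]
          refine hE.symm ⟨v, hv, hv1, ?_⟩
          rw [pow_one, pow_zero, mul_one] at hg
          exact hg
        · -- `W = w₂μ`: `ρ(w₂μ) = ρ(w₂)ρ(μ)`
          right; right; right
          show Quot.mk S p₁ = Quot.mk S (aM (aA p₂))
          rw [hiff]
          refine hE.symm ⟨v, hv, hv1, ?_⟩
          rw [pow_one, pow_one, moebius_rho_castQ_mul₄ (by rw [hnm]; norm_num) (by rw [hnw]; norm_num) p₂.2.1] at hg
          exact hg

/-- **`#(Pt(t)/Γ₆⁺) = |L(t)/N(O₆)|` for `t > 0`, `3 ∤ t`, `t ≡ 3 (mod 4)`**: the points of `Z(t)` on `X₆⁺ = X₆/W` are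
counted by the special vectors up to Atkin–Lehner (`#(Pt(t)/Γ₆) = |L(t)/O₆^×| = 4·|L(t)/N(O₆)|`,
`…NormaliserClassBounds`, and the four sheets above). [cite: KudlaRapoportYang2006, §3.4 Remark 3.4.7 and (3.4.11)–(3.4.13)] [cite: BayerTravesa2007, §2] -/
theorem card_specialPointsPlus_eq_card_normaliser_classes {t : ℤ} (ht : 0 < t) (h3 : ¬ (3 : ℤ) ∣ t)
    (h4 : t % 4 = 3) :
    Nat.card (Quot (fun p q : {τ : ℂ // 0 < τ.im ∧ ∃ x : ℍ[ℚ,((-1 : ℤ) : ℚ),((3 : ℤ) : ℚ)],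
        x ∈ order (-1) 3 ∧ x.re = 0 ∧ (x * star x).re = t ∧ moebius (rho (-1) 3 (by norm_num) (castQ (-1) 3 x)) τ = τ} ↦
      ∃ g : ℍ[ℚ,((-1 : ℤ) : ℚ),((3 : ℤ) : ℚ)], g ≠ 0 ∧
        (∀ a : ℍ[ℚ,((-1 : ℤ) : ℚ),((3 : ℤ) : ℚ)], (a ∈ order (-1) 3 ∨ a - ⟨1/2, 1/2, 1/2, -1/2⟩ ∈ order (-1) 3) →
          ∃ b : ℍ[ℚ,((-1 : ℤ) : ℚ),((3 : ℤ) : ℚ)], (b ∈ order (-1) 3 ∨ b - ⟨1/2, 1/2, 1/2, -1/2⟩ ∈ order (-1) 3) ∧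
            g * a = b * g) ∧
        0 < (g * star g).re ∧ moebius (rho (-1) 3 (by norm_num) (castQ (-1) 3 g)) p.1 = q.1)) =
    Nat.card (Quot (fun x y : {x : ℤ × ℤ × ℤ // x.1 ^ 2 - 3 * x.2.1 ^ 2 - 3 * x.2.2 ^ 2 = t} ↦
      ∃ g : ℍ[ℚ,((-1 : ℤ) : ℚ),((3 : ℤ) : ℚ)], g ≠ 0 ∧
        (∀ a : ℍ[ℚ,((-1 : ℤ) : ℚ),((3 : ℤ) : ℚ)], (a ∈ order (-1) 3 ∨ a - ⟨1/2, 1/2, 1/2, -1/2⟩ ∈ order (-1) 3) →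
          ∃ b : ℍ[ℚ,((-1 : ℤ) : ℚ),((3 : ℤ) : ℚ)], (b ∈ order (-1) 3 ∨ b - ⟨1/2, 1/2, 1/2, -1/2⟩ ∈ order (-1) 3) ∧
            g * a = b * g) ∧
        g * ⟨0, x.1.1, x.1.2.1, x.1.2.2⟩ = ⟨0, y.1.1, y.1.2.1, y.1.2.2⟩ * g)) := by
  have h1 := card_specialPoints_eq_four_mul_card_specialPointsPlus ht h3 h4
  have h2 := card_specialPoints_eq_four_mul_card_normaliser_classes ht h3 h4
  omega

/-- **`Z(19)` HAS EXACTLY ONE POINT ON `X₆⁺`** (`#(Pt(19)/Γ₆⁺) = |L(19)/N(O₆)| = 1`; four points on `X₆`). [cite: KudlaRapoportYang2006, §3.4 Remark 3.4.7 and (3.4.13)] [cite: BayerTravesa2007, §2] -/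
theorem card_specialPointsPlus_nineteen :
    Nat.card (Quot (fun p q : {τ : ℂ // 0 < τ.im ∧ ∃ x : ℍ[ℚ,((-1 : ℤ) : ℚ),((3 : ℤ) : ℚ)],
        x ∈ order (-1) 3 ∧ x.re = 0 ∧ (x * star x).re = ((19 : ℤ) : ℚ) ∧ moebius (rho (-1) 3 (by norm_num) (castQ (-1) 3 x)) τ = τ} ↦
      ∃ g : ℍ[ℚ,((-1 : ℤ) : ℚ),((3 : ℤ) : ℚ)], g ≠ 0 ∧
        (∀ a : ℍ[ℚ,((-1 : ℤ) : ℚ),((3 : ℤ) : ℚ)], (a ∈ order (-1) 3 ∨ a - ⟨1/2, 1/2, 1/2, -1/2⟩ ∈ order (-1) 3) →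
          ∃ b : ℍ[ℚ,((-1 : ℤ) : ℚ),((3 : ℤ) : ℚ)], (b ∈ order (-1) 3 ∨ b - ⟨1/2, 1/2, 1/2, -1/2⟩ ∈ order (-1) 3) ∧
            g * a = b * g) ∧
        0 < (g * star g).re ∧ moebius (rho (-1) 3 (by norm_num) (castQ (-1) 3 g)) p.1 = q.1)) = 1 := by
  rw [card_specialPointsPlus_eq_card_normaliser_classes (t := 19) (by norm_num) (by norm_num) (by norm_num)]
  exact card_normaliser_classes_nineteen

end Count

end Literature.Geometry.Kaehler.ComplexTorus.QuaternionType
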